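import Summits.QuantumFields.YangMills.Theorems.BalabanUVNodesN15KingModelPotentialDressedTower
import Summits.QuantumFields.YangMills.Theorems.BalabanUVNodesN15KingModelPotentialLetters

/-!
# Route «BalabanUVNodes» (K4 «SpineRates»), node N15 = NE2 — THE KING-MODEL RUNG, part 9d: `NE2PlusUnit` BY NAME FOR KING'S TOWER FULLY DRESSED BY A
# POTENTIAL TOWER — (3.35) := SIZE, whose consequence (k-uniform LOCALITY of `Δ^{(k)}_v − Δ^{(k)}`) is now a THEOREM (part 9c); (3.36) := the
# η-rate of the FULL perturbation, READ

Cell `pub-ymgap`, Track A (D-0062), seat `pub-ymgap-dag-n15-d` (R134 seat, strategy s3, gen 7).  `bears_on: R4∕N15`; `--supports` the K3‴ item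
`SpineGivenEndpointR13` (stmt-QuantumFields-19912).  COUNT-NEUTRAL; definition lane (a background sort, the instance family, the dressed kernel ∕
distance are data; every theorem is by-name plumbing of parts 3, 6a, 6b, 9c).  Imports parts 9c and 8b.

WHERE THIS SITS.  Part 6b fired the unit-layer socket with an ABSTRACT perturbation tower `E` whose TWO letters — locality (3.35) and η-rate (3.36) — were
READ (`kingBg`); part 8c DERIVED both letters but only for the FIRST VARIATION `Δ^{(k)} + δΔ^{(k)}[v]` of the dressing along a potential tower
(`ne2PlusUnit_kingV`).  Part 9c proved that the FULL perturbation `E(v) = Δ^{(k)}_v − Δ^{(k)}` is k-uniformly local with constant `∝ sup|v|`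
(`uniformKernelDecay_fullPert`).  THIS FILE fires the socket for the FULLY dressed tower with the background sort **`potBgW`**: configurations =
potential towers `v = (v_N)_N`; **(3.35) at `(c₃₅, α₀)` := the SIZE letter** `sup_{N,x}|v_N(x)| ≤ c₃₅α₀` (its use — locality of `E(v)` — is a
THEOREM); **(3.36) at `(c₃₅, α₀)` := the η-RATE letter of the full perturbation** `|E_{j+1}(v) − E_j(v)|(z,w) ≤ c₃₅α₀·r^j` (READ: nonperturbatively it
needs the `A = 0` instance of King's Prop. 3.9, not in the tree; parts 8a∕8b prove it for the first variation along a coherent tower).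
* §1 `potBgW`, `fullPert_zero` (the zero tower is the trivial background: `E(0) = 0`), `potBgW_reg_zero`, the dressed family
  `kingInstanceW` (part 1's realised King geometries on every torus `Π ℤ∕(LM_μ)`, `KingIndex`; identity pairing `kingPairingW`), the dressed unit kernel
  `kingKerW` (`(y,y′) ↦ C_v^{(k+1)}(y,y′) − C_v^{(k)}(y,y′)`, the one-step η-difference of the FULLY dressed covariances, `kingCovE (fullPert v)` of
  parts 6b∕9c), `kingKerW_apply` (in terms of `(Δ_v + aL⁻²Q*Q)⁻¹`), `kingKerW_zero` (= part 3's `kingKer1` at `v = 0`), `kingDistW`, the window `potWindow`, `potWindow_pos`.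
* §2 ★★ **`ne2PlusUnit_kingW`**: for `L ≥ 2`, `a, m² > 0`, every `c₃₅ > 0` and every ratio `L⁻² ≤ r < 1`,
  `NE2PlusUnit c35 (kingInstanceW a m² r) (kingKerW a m² r) ⊤ tdistT` — window `a₀ := potWindow∕c₃₅` with `potWindow = min(w̄, c̄, c̄∕(a²·ctCK²·K_W))` (so that
  `c₃₅α₀ ≤ w̄` feeds 9c's letter and its constant `a²ctCK²K_W·c₃₅α₀ ≤ c̄` keeps 6b's gap); part 3's free leaves (sup-rate leaf at ratio `r` by
  monotonicity); part 6a's socket `ne2PlusUnit_of_freeLeaves_add`; constants `(δ₀, a₀, B₀, θ)` uniform in the index AND the potential; ★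
  `ne2ZeroUnit_kingW`.

HONEST FRAMING ∕ LIMITS.  King's `A = 0` SCALAR block-spin tower (periodic b.c., flat blocks), dressed NONPERTURBATIVELY by a scalar potential tower
(`Δ^{(k)}_v` itself, no truncation) — a potential is NOT a gauge field; of the two regularity letters ONE ((3.35) ⇒ locality) is now a theorem and ONE
((3.36) = η-rate of `E(v)`) remains a READING asserted by nobody; nothing here is Bałaban's `Δ^{(k)}(U) − Δ^{(k)}(1)`, `G(U)`, `C^{(k)}(Λ;U)`
(η-differences NOT PRINTED); NOT the carriers of record (NODE 00); NOT a node discharge; typed 28∕28, discharged count untouched; one finite torus at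
fixed ε — NOT ℝ⁴ ∕ infinite volume ∕ OS ∕ mass gap ∕ Clay.  Locators: [King1986] CMP **102** (1986): Lemma 4.5 (4.38) p. 674 with (4.32)–(4.34), Lemma 4.3
(4.18) p. 672, (4.39)–(4.41) p. 675; [B9] = [Balaban1985BackgroundPropagators] CMP **99** (1985): (3.35)–(3.36) p. 396 (slots), Thm 3.15 (3.187)
p. 432 (quantifier template).
-/

noncomputable section

open scoped BigOperators Matrix
open Finset

namespace Summit.QuantumFields.YangMills.BalabanUVNodes.N15.KingModel

open Literature.MathematicalPhysics.QuantumFieldTheory.Balaban1983to89 hiding blockOf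
open Literature.MathematicalPhysics.QuantumFieldTheory.Balaban1983to89.QGQInverse (Coercive)
open Literature.MathematicalPhysics.QuantumFieldTheory.Balaban1983to89.B4Sect5Proof (latticeConst latticeConst_nonneg)
open Literature.MathematicalPhysics.QuantumFieldTheory.Balaban1983to89.B5Prop11Plancherel (Tor fine)
open Literature.MathematicalPhysics.QuantumFieldTheory.Balaban1983to89.T4EtaRate (PairedInstance EtaPairing NE2PlusUnit)
open Literature.MathematicalPhysics.QuantumFieldTheory.Balaban1983to89.T4EtaRateUnitWitness (NE2ZeroUnit ne2ZeroUnit_of_ne2PlusUnit)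
open Literature.MathematicalPhysics.QuantumFieldTheory.King1986.Torus (tdistT tdistT_isPseudoDist aminL aminL_pos CDelU CDelU_pos gam0L gam0L_pos
  kapCT kapCT_pos_le V45 thetaBar delta45 gamA gamA_pos)
open Summit.QuantumFields.BalabanUV.T4Continuum.NE2KingTransplant (IsPseudoMetric UniformCoercive UniformCTBound UniformKernelDecay
  EffectiveOperatorSupRate VolumeSum)

variable {d : ℕ}

/-! ## §1 The background sort of potential towers for the FULL dressing; the dressed family, kernel and window -/

section PotSortW

variable (a m2 : ℝ) (L : ℕ) [NeZero L]

/-- **THE BACKGROUND SORT OF POTENTIAL TOWERS FOR THE FULLY DRESSED KING TOWER** over the unit torus `Π ℤ∕(LM_μ)`: a configuration is a potential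
`v_N` on the fine torus `Π ℤ∕(N·LM_μ)` for every fine count `N`; trivial background = the zero tower; composition = addition; **(3.35) at
`(c₃₅, α₀)` := the SIZE letter** `sup_{N,x}|v_N(x)| ≤ c₃₅α₀` (small field; its consequence, k-uniform locality of `Δ^{(k)}_v − Δ^{(k)}`, is part 9c's
THEOREM `uniformKernelDecay_fullPert`); **(3.36) at `(c₃₅, α₀)` := the η-RATE letter of the FULL perturbation** `|E_{j+1}(v) − E_j(v)|(z,w) ≤ c₃₅α₀·r^j`
(`E(v) = fullPert a m² L M v`; READ — the model's analogue of the Spine's (H-cons), proved in the tree only for the first variation along coherent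
towers, parts 8a∕8b); complex-extension sorts inert.  HONEST SCOPE: scalar potentials, NOT gauge fields; the slots are OUR reading for this model.
[cite: Balaban1985BackgroundPropagators, (3.35)–(3.36) p.396 (the two regularity slots: typing template)] -/
@[reducible] def potBgW (r : ℝ) (M : Fin (d + 1) → ℕ) [∀ μ, NeZero (M μ)] : B9.Backgrounds where
  Cfg := ∀ N : ℕ, Tor (fine N (fine L M)) → ℝ
  one := fun _ _ => 0
  mul := fun v v' N x => v N x + v' N x
  Reg335 := fun c35 α₀ v => ∀ (N : ℕ) (x : Tor (fine N (fine L M))), |v N x| ≤ c35 * α₀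
  Reg336 := fun c35 α₀ v => EffectiveOperatorSupRate (fullPert a m2 L M v) (c35 * α₀) r
  Cplx337 := fun _ _ _ => True
  Cplx338 := fun _ _ _ => True

variable {a m2 L}

/-- THE ZERO POTENTIAL TOWER IS THE TRIVIAL BACKGROUND: `E(0) = 0` (`Δ^{(k)}_0 = Δ^{(k)}`, part 8d's `kingLevelPot_zero`). [folklore] -/
theorem fullPert_zero (M : Fin (d + 1) → ℕ) [∀ μ, NeZero (M μ)] : fullPert a m2 L M (fun _ _ => 0) = 0 := by
  funext j
  rw [fullPert_apply, Pi.zero_apply]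
  exact sub_self _

/-- THE SORT IS POPULATED: the zero tower is (3.35)∧(3.36)-regular at every size `c₃₅α₀ ≥ 0` (`r ≥ 0`). [folklore] -/
theorem potBgW_reg_zero {r : ℝ} (hr : 0 ≤ r) (M : Fin (d + 1) → ℕ) [∀ μ, NeZero (M μ)] {c35 α₀ : ℝ} (hc : 0 ≤ c35 * α₀) :
    (potBgW (d := d) a m2 L r M).Reg335 c35 α₀ (fun _ _ => 0) ∧ (potBgW (d := d) a m2 L r M).Reg336 c35 α₀ (fun _ _ => 0) := by
  refine ⟨fun N x => by rw [abs_zero]; exact hc, fun j z w => ?_⟩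
  show |(fullPert a m2 L M (fun _ _ => 0) (j + 1) - fullPert a m2 L M (fun _ _ => 0) j) z w| ≤ c35 * α₀ * r ^ j
  rw [fullPert_zero, Pi.zero_apply, Pi.zero_apply, sub_self, Matrix.zero_apply, abs_zero]
  positivity

/-- The background sort at an index of the King family (any torus, part 1's `KingIndex`). [folklore] -/
@[reducible] def kingBgW (a m2 r : ℝ) (i : KingIndex d L) : B9.Backgrounds := potBgW a m2 L r i.Mn

/-- THE η-PAIRING of part 1's two King geometries with the potential sort live on both sides (identity on sites, arguments and backgrounds).
[cite: King1986, p.664 (convention before Prop. 3.8)] -/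
def kingPairingW (a m2 r : ℝ) (i : KingIndex d L) : EtaPairing (kingGeoC i) (kingGeoF i) (kingBgW a m2 r i) (kingBgW a m2 r i) where
  n := i.n
  k_eq := rfl
  L_eq := rfl
  M_eq := rfl
  eta_eq := (kingPairing i).eta_eq
  ι := fun y => y
  scale_ι := fun _ => rfl
  dist_ι := fun _ _ => rfl
  τ := fun lam => lam
  suppIn_τ := fun _ _ h => h
  supNorm_τ := fun _ => le_rfl
  avg := fun v => v
  avg_one := rfl

/-- THE FULLY DRESSED KING FAMILY WITH A LIVE POTENTIAL: part 1's realised geometries on every torus, the potential sort on both sides.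
[cite: Balaban1985BackgroundPropagators, Thm 3.14 pp.426–427 (typing template)] -/
def kingInstanceW (a m2 r : ℝ) (i : KingIndex d L) : PairedInstance :=
  ⟨kingGeoC i, kingGeoF i, kingBgW a m2 r i, kingBgW a m2 r i, kingPairingW a m2 r i⟩

/-- THE FULLY DRESSED UNIT KERNEL: at index `i` and potential tower `v`, `(y, y′) ↦ C_v^{(k+1)}(y, y′) − C_v^{(k)}(y, y′)`, the one-step η-difference of
the covariances of King's tower dressed NONPERTURBATIVELY by `v` (part 6b's `kingCovE` at the full perturbation `fullPert v`).
[cite: King1986, Lemma 4.5 (4.38) p.674 (the differenced object, A = 0); Balaban1985BackgroundPropagators, Thm 3.15 (3.187) p.432 (C^{(k)}(Λ;U): shape)] -/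
def kingKerW (a m2 r : ℝ) (i : KingIndex d L) : B9.SiteKernel (kingInstanceW a m2 r i).gc (kingInstanceW a m2 r i).Bf :=
  ⟨fun v y y' => kingCovE a m2 L i.Mn (fullPert a m2 L i.Mn v) (i.k + 1) y y' - kingCovE a m2 L i.Mn (fullPert a m2 L i.Mn v) i.k y y'⟩

/-- `unitDist :=` King's periodic unit-lattice distance. [cite: King1986, Lemma 4.5 (4.38) p.674] -/
def kingDistW (a m2 r : ℝ) : ∀ i : KingIndex d L, (kingInstanceW a m2 r i).gc.Site → (kingInstanceW a m2 r i).gc.Site → ℝ :=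
  fun i y y' => tdistT (kingTor i) y y'

/-- The dressed kernel in terms of the fully dressed tower: `C_v^{(j)} = (Δ^{(max j 1)}_{v} + aL⁻²Q*Q)⁻¹` (part 9c's `kingCovE_fullPert`). [folklore] -/
theorem kingKerW_apply (r : ℝ) (i : KingIndex d L) (v : ∀ N : ℕ, Tor (fine N (kingTor i)) → ℝ) (y y' : Tor (kingTor i)) :
    (kingKerW a m2 r i).ker v y y'
      = (kingTowerPot a m2 L i.Mn v (i.k + 1) + kingBlock a L i.Mn)⁻¹ y y' - (kingTowerPot a m2 L i.Mn v i.k + kingBlock a L i.Mn)⁻¹ y y' := by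
  show kingCovE a m2 L i.Mn (fullPert a m2 L i.Mn v) (i.k + 1) y y' - kingCovE a m2 L i.Mn (fullPert a m2 L i.Mn v) i.k y y' = _
  rw [kingCovE_fullPert, kingCovE_fullPert]

/-- At the zero tower the dressed kernel IS part 3's one-step King kernel `kingKer1` (consistency with parts 3 and 6b). [folklore] -/
theorem kingKerW_zero (r : ℝ) (i : KingIndex d L) (y y' : Tor (kingTor i)) :
    (kingKerW a m2 r i).ker (kingInstanceW a m2 r i).Bf.one y y' = (kingKer1 a m2 i).ker () y y' := by
  show kingCovE a m2 L i.Mn (fullPert a m2 L i.Mn (fun _ _ => 0)) (i.k + 1) y y' - kingCovE a m2 L i.Mn (fullPert a m2 L i.Mn (fun _ _ => 0)) i.k y y'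
    = (kingKer1 a m2 i).ker () y y'
  rw [fullPert_zero, ← kingKerE_zero i y y']
  rfl

/-- THE POTENTIAL WINDOW OF THE SOCKET: `potWindow = min(min(w̄, c̄), c̄∕(a²·ctCK²·K_W))` — sizes `c₃₅α₀ ≤ potWindow` feed part 9c's letter (`≤ w̄`), keep its
constant `a²ctCK²K_W·c₃₅α₀ ≤ c̄`, and keep the read η-rate `≤ c̄` (part 6b's threshold `c̄ = kingCbar`). [folklore] -/
def potWindow (dd : ℕ) (a : ℝ) (L : ℕ) : ℝ :=
  min (min (wbarK dd a L) (kingCbar dd a L)) (kingCbar dd a L / (a ^ 2 * ctCK dd a L ^ 2 * kwSum dd a L))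

omit [NeZero L] in
/-- `potWindow > 0` for `L ≥ 2`, `a > 0`. [folklore] -/
theorem potWindow_pos {a : ℝ} (ha : 0 < a) (hL : 2 ≤ L) : 0 < potWindow (d + 1) a L := by
  obtain ⟨-, -, hw⟩ := dressedConsts_nonneg (d := d) ha hL
  have hcb := kingCbar_pos (dd := d + 1) ha hL
  have hCK : 0 < ctCK (d + 1) a L := by unfold ctCK; have := gamA_pos (aminL_pos ha hL) (d + 1); positivity
  have hK : 0 < kwSum (d + 1) a L := latticeConst_pos (d + 1) (by have := (kapCT_pos_le (d := d + 1) ha hL).1; positivity)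
  unfold potWindow
  exact lt_min (lt_min hw hcb) (by positivity)

end PotSortW

/-! ## §2 The socket fires for the fully dressed tower: `NE2PlusUnit` by name, (3.35) consumed as a theorem, (3.36) consumed as read -/

section Socket

variable {a m2 : ℝ} {L : ℕ} [NeZero L]

/-- **THE SOCKET FIRES FOR KING'S TOWER FULLY DRESSED BY A POTENTIAL — `NE2PlusUnit` BY NAME** (torus dimension `d + 1`, `L ≥ 2`, `a, m² > 0`, every
`c₃₅ > 0`, every ratio `L⁻² ≤ r < 1`): on the family `kingInstanceW a m² r` (index = torus, `k ≥ 1`, shift, direction, free size letter `Msz ≥ 1`;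
backgrounds = POTENTIAL TOWERS with (3.35) := size, (3.36) := η-rate of the full perturbation at ratio `r`) with the FULLY dressed one-step unit kernel
`kingKerW` (`C_v^{(k+1)} − C_v^{(k)}`, `C_v^{(j)} = (Δ^{(max j 1)}_v + aL⁻²Q*Q)⁻¹`), `inΛ := ⊤`, `unitDist := tdistT`:
`NE2PlusUnit c35 (kingInstanceW a m² r) (kingKerW a m² r) ⊤ tdistT`.  Mechanism: window `a₀ := potWindow∕c₃₅`; at a regular potential of size `c₃₅α₀ ≤ potWindow`
the LOCALITY letter of `E(v) = Δ_v − Δ` is part 9c's THEOREM `uniformKernelDecay_fullPert` (constant `a²ctCK²K_W·c₃₅α₀ ≤ c̄`, rate `κ′`), the η-rate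
letter is the read (3.36) (`≤ c̄` by monotonicity); part 3's free leaves (sup-rate leaf moved to ratio `r`); 6b's gap `ρ + ρ_B + 2c̄V < γ₀` (`kingGap`);
part 6a's socket `ne2PlusUnit_of_freeLeaves_add`.  Constants `(δ₀, a₀, B₀, θ)` uniform in the index AND the potential (`θ = √r`).  HONEST SCOPE: King's
`A = 0` scalar tower dressed nonperturbatively by a scalar potential; (3.36) for `E(v)` READ, not proved; NOT Bałaban's `C^{(k)}(Λ; U)` nor a gauge-field
background; NOT a node discharge; count-neutral. [cite: King1986, Lemma 4.5 (4.38) p.674 with (4.33)–(4.34), Lemma 4.3 (4.18) p.672, (4.39)–(4.41) p.675; Balaban1985BackgroundPropagators, Thm 3.15 (3.187) p.432 (quantifier template), (3.35)–(3.36) p.396 (slots)] -/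
theorem ne2PlusUnit_kingW (hL : 2 ≤ L) (ha : 0 < a) (hm : 0 < m2) {c35 : ℝ} (hc : 0 < c35) {r : ℝ} (hr0 : ((L : ℝ) ^ 2)⁻¹ ≤ r) (hr1 : r < 1) :
    NE2PlusUnit c35 (kingInstanceW (d := d) (L := L) a m2 r) (kingKerW a m2 r) (fun _ _ => True) (kingDistW a m2 r) := by
  have hamin := aminL_pos ha hL
  have hθ := thetaBar_mul_nonneg (a := a) ha hL
  have hcb := kingCbar_pos (dd := d + 1) ha hL
  have hLinv : 0 < ((L : ℝ) ^ 2)⁻¹ := by positivity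
  have hrpos : 0 < r := lt_of_lt_of_le hLinv hr0
  have hpw := potWindow_pos (d := d) ha hL
  obtain ⟨hCK, hKW, hwb⟩ := dressedConsts_nonneg (d := d) ha hL
  refine ne2PlusUnit_of_freeLeaves_add (c35 := c35) (pi := kingInstanceW (d := d) (L := L) a m2 r) (Kd := kingKerW a m2 r)
    (inΛ := fun _ _ => True) (unitDist := kingDistW a m2 r) (m := fun i => Tor (kingTor i)) (a₀ := potWindow (d + 1) a L / c35)
    (div_pos hpw hc) (fun _ y => y) (fun i => tdistT (kingTor i)) (fun i => kingTower a m2 L i.Mn) (fun i v => fullPert a m2 L i.Mn v)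
    (fun i => kingBlock a L i.Mn) (cE := kingCbar (d + 1) a L) (εE := kingCbar (d + 1) a L)
    (kingGap (dd := d + 1) ha hL le_rfl) (kapCT_pos_le (d := d + 1) ha hL).1 (by positivity)
    (by have := CDelU_pos (d := d + 1) ha hamin; positivity) hcb.le (V45_pos (d + 1) ha hL) hrpos hr1
    (fun i => isPseudoMetric_tdistT (kingTor i)) (fun _ _ _ => le_rfl)
    (fun i => ⟨uniformCoercive_kingTower ha hm hL, uniformCTBound_kingTower ha hm hL, uniformKernelDecay_kingTower ha hm hL,
      effectiveOperatorSupRate_mono_rate hθ hLinv.le hr0 (effectiveOperatorSupRate_kingTower ha hm hL), volumeSum_kingTorus ha hL⟩)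
    fun i α₀ hα hMa v h335 h336 => ?_
  -- the size of the potential inside the window
  have hsize : c35 * α₀ ≤ potWindow (d + 1) a L := by
    have h1 : α₀ ≤ i.Msz * α₀ := le_mul_of_one_le_left hα.le i.one_le_Msz
    have h2 : α₀ ≤ potWindow (d + 1) a L / c35 := h1.trans hMa
    rwa [le_div_iff₀ hc, mul_comm] at h2
  have hwbar : c35 * α₀ ≤ wbarK (d + 1) a L := hsize.trans ((min_le_left _ _).trans (min_le_left _ _))
  have hcbar : c35 * α₀ ≤ kingCbar (d + 1) a L := hsize.trans ((min_le_left _ _).trans (min_le_right _ _))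
  have hquot : c35 * α₀ ≤ kingCbar (d + 1) a L / (a ^ 2 * ctCK (d + 1) a L ^ 2 * kwSum (d + 1) a L) := hsize.trans (min_le_right _ _)
  -- the locality letter is 9c's theorem; the η-rate letter is read
  have l1 := uniformKernelDecay_fullPert (M := i.Mn) ha hm hL hwbar h335
  have hcE : a ^ 2 * ctCK (d + 1) a L ^ 2 * kwSum (d + 1) a L * (c35 * α₀) ≤ kingCbar (d + 1) a L := by
    rcases (mul_nonneg (mul_nonneg (sq_nonneg a) (sq_nonneg _)) hKW).eq_or_lt with hz | hpos
    · rw [← hz, zero_mul]; exact hcb.le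
    · rw [le_div_iff₀ hpos] at hquot
      linarith [hquot]
  exact ⟨uniformKernelDecay_mono l1 hcE, effectiveOperatorSupRate_mono hrpos.le h336 hcbar, fun y y' => rfl⟩

/-- … and the trivial-background unit layer `NE2ZeroUnit` of the fully dressed family (the zero tower is regular at every size). [cite: King1986, Lemma 4.5 (4.38) p.674] -/
theorem ne2ZeroUnit_kingW (hL : 2 ≤ L) (ha : 0 < a) (hm : 0 < m2) {r : ℝ} (hr0 : ((L : ℝ) ^ 2)⁻¹ ≤ r) (hr1 : r < 1) :
    NE2ZeroUnit (kingInstanceW (d := d) (L := L) a m2 r) (kingKerW a m2 r) (fun _ _ => True) (kingDistW a m2 r) := by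
  have hr : 0 ≤ r := le_trans (by positivity) hr0
  refine ne2ZeroUnit_of_ne2PlusUnit (c35 := 1) (fun i => lt_of_lt_of_le one_pos i.one_le_Msz) (fun i α₀ hα => ?_) (fun i α₀ hα => ?_)
    (ne2PlusUnit_kingW hL ha hm one_pos hr0 hr1)
  · exact (potBgW_reg_zero (a := a) (m2 := m2) (L := L) hr i.Mn (c35 := 1) (α₀ := α₀) (by positivity)).1
  · exact (potBgW_reg_zero (a := a) (m2 := m2) (L := L) hr i.Mn (c35 := 1) (α₀ := α₀) (by positivity)).2

end Socket

end Summit.QuantumFields.YangMills.BalabanUVNodes.N15.KingModel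

end
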